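import Literature.Analysis.UnboundedOperators.StrongContRepresentationDerivProofs
import Literature.Analysis.UnboundedOperators.StrongContRepresentationDensityProofs
import Mathlib.MeasureTheory.Integral.IntervalIntegral.FundThmCalculus
import HarnessLib

/-!
# Uniqueness of the C₀-semigroup with a given generator, and the variation-of-parameters (Duhamel)
  formula for bounded perturbations (Engel–Nagel II.1.4, III Cor. 1.7)

Analysis/UnboundedOperators proofs-layer file (theorems only, no definitions, no named facts), for
the tree's `C0Semigroup 𝕜 E` (`StrongContRepresentation.lean`) on a Banach space carrying a
compatible real structure (as in `StrongContRepresentationDerivProofs.lean`). Engel–Nagel (2000):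

* §1 `tendsto_app_apply` — JOINT CONTINUITY `(τ, w) ↦ T(τ)w` along any filter with bounded times
  (local boundedness I.5.5 + strong continuity);
* §2 `hasDerivWithinAt_app_sub_apply` — the PRODUCT RULE behind every "`d/ds T(t − s)v(s)`"
  argument (proof of II.1.4, III.1.7, Appendix B.16): if `v` has derivative `v′` at `s₀ < t` (within
  a set) and `v(s₀) ∈ D(A)`, then `s ↦ T(t − s)v(s)` has derivative `T(t − s₀)v′ − T(t − s₀)Av(s₀)`;
* §3 **`app_eq_add_integral_of_generator`** (III Cor. 1.7, the variation of parameters formula): if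
  `S`, `T` are C₀-semigroups whose generators have THE SAME DOMAIN and differ there by a bounded
  operator, `A_S u = A_T u + K u`, then for EVERY `x` and `t ≥ 0`

    `S(t)x = T(t)x + ∫₀ᵗ T(t − s) K S(s)x ds`

  (for `x ∈ D(A)` by §2 and the fundamental theorem of calculus; for all `x` by density of `D(A)`
  and continuity of both sides); and its case `K = 0`,
  **`app_eq_of_generator_eq`** (II Thm. 1.4: a C₀-semigroup is uniquely determined by its generator).

These make the semigroups produced by the Hille–Yosida / bounded-perturbation files
(`HilleYosida*.lean`: `∃ S, S.generator = …`) canonical, and provide the mild-solution identity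
behind Dyson–Phillips / renewal arguments (the tree's `LinearMildFlow*` files assume a NORM-continuous
semigroup and do not apply to a merely strongly continuous one).

## References

* K.-J. Engel, R. Nagel, *One-Parameter Semigroups for Linear Evolution Equations* (2000),
  Ch. II Thm. 1.4 (uniqueness), Ch. III Cor. 1.7 (variation of parameters formula), Appendix B
  Lemma B.16, Ch. I Prop. 5.5. [EngelNagel2000]
* A. Pazy, *Semigroups of Linear Operators and Applications to PDE* (1983), Thm. 1.2.6, §3.1 (1.2).
-/

noncomputable section

open MeasureTheory Set Filter Topology
open scoped NNReal

namespace Literature.Analysis.UnboundedOperators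

namespace C0Semigroup

variable {𝕜 E : Type*} [RCLike 𝕜] [NormedAddCommGroup E] [NormedSpace 𝕜 E]

/-! ### §1 Joint continuity `(τ, w) ↦ T(τ)w` -/

/-- **Joint continuity of `(τ, w) ↦ T(τ)w` with bounded times**: if `τᵢ → τ₀` with `τᵢ ≤ t_max`
eventually and `wᵢ → w₀`, then `T(τᵢ)wᵢ → T(τ₀)w₀` (`‖T(τᵢ)(wᵢ − w₀)‖ ≤ M‖wᵢ − w₀‖` by the local
bound, plus strong continuity at `w₀`). [cite: EngelNagel2000, Ch. I Prop. 5.5] -/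
theorem tendsto_app_apply [CompleteSpace E] (T : C0Semigroup 𝕜 E) {ι : Type*} {l : Filter ι}
    {τ : ι → ℝ≥0} {τ₀ tmax : ℝ≥0} (hτ : Tendsto τ l (𝓝 τ₀)) (hbd : ∀ᶠ i in l, τ i ≤ tmax)
    {w : ι → E} {w₀ : E} (hw : Tendsto w l (𝓝 w₀)) :
    Tendsto (fun i => T.app (τ i) (w i)) l (𝓝 (T.app τ₀ w₀)) := by
  obtain ⟨M, hM⟩ := T.exists_norm_app_le tmax
  have h1 : Tendsto (fun i => T.app (τ i) w₀) l (𝓝 (T.app τ₀ w₀)) := ((T.continuous_app w₀).tendsto τ₀).comp hτ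
  have h2 : Tendsto (fun i => ‖w i - w₀‖) l (𝓝 0) := by
    have := (hw.sub_const w₀).norm
    rwa [sub_self, norm_zero] at this
  rw [tendsto_iff_norm_sub_tendsto_zero]
  have h3 : Tendsto (fun i => M * ‖w i - w₀‖ + ‖T.app (τ i) w₀ - T.app τ₀ w₀‖) l (𝓝 0) := by
    have := (h2.const_mul M).add (tendsto_iff_norm_sub_tendsto_zero.1 h1)
    rwa [mul_zero, zero_add] at this
  refine squeeze_zero' (Eventually.of_forall fun i => norm_nonneg _) ?_ h3
  filter_upwards [hbd] with i hi
  calc ‖T.app (τ i) (w i) - T.app τ₀ w₀‖ = ‖T.app (τ i) (w i - w₀) + (T.app (τ i) w₀ - T.app τ₀ w₀)‖ := by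
        rw [map_sub]; congr 1; abel
    _ ≤ ‖T.app (τ i) (w i - w₀)‖ + ‖T.app (τ i) w₀ - T.app τ₀ w₀‖ := norm_add_le _ _
    _ ≤ M * ‖w i - w₀‖ + ‖T.app (τ i) w₀ - T.app τ₀ w₀‖ :=
        add_le_add ((ContinuousLinearMap.le_opNorm _ _).trans (mul_le_mul_of_nonneg_right (hM _ hi) (norm_nonneg _))) le_rfl

/-- Continuity of `s ↦ T((t − s)⁺)(w s)` for a continuous `w` (real time, clipped at `0`).
[cite: EngelNagel2000, Ch. I Prop. 5.5] -/
theorem continuous_app_sub_apply [CompleteSpace E] (T : C0Semigroup 𝕜 E) (t : ℝ) {w : ℝ → E} (hw : Continuous w) :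
    Continuous fun s : ℝ => T.app (t - s).toNNReal (w s) := by
  rw [continuous_iff_continuousAt]
  intro s₀
  have hτ : Tendsto (fun s : ℝ => (t - s).toNNReal) (𝓝 s₀) (𝓝 (t - s₀).toNNReal) :=
    (continuous_real_toNNReal.comp (continuous_const.sub continuous_id)).tendsto s₀
  have hbd : ∀ᶠ s in 𝓝 s₀, (t - s).toNNReal ≤ (t - s₀ + 1).toNNReal := by
    filter_upwards [Ioi_mem_nhds (show s₀ - 1 < s₀ by linarith)] with s hs
    exact Real.toNNReal_le_toNNReal (by linarith [mem_Ioi.1 hs])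
  exact T.tendsto_app_apply hτ hbd (hw.tendsto s₀)

variable [NormedSpace ℝ E] [IsScalarTower ℝ 𝕜 E] [CompleteSpace E]

/-! ### §2 The product rule for `s ↦ T(t − s) v(s)` -/

/-- `s ↦ T(t − s) y` has derivative `−T(t − s₀)Ay` at `s₀ < t`, for `y ∈ D(A)`.
[cite: EngelNagel2000, Ch. II Lemma 1.3] -/
theorem hasDerivAt_app_sub_const (T : C0Semigroup 𝕜 E) {t s₀ : ℝ} (hst : s₀ < t) (y : T.generator.domain) :
    HasDerivAt (fun s : ℝ => T.app (t - s).toNNReal (y : E)) (-(T.app (t - s₀).toNNReal (T.generator y))) s₀ := by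
  have hpos : 0 < (t - s₀).toNNReal := Real.toNNReal_pos.2 (sub_pos.2 hst)
  have h := T.hasDerivAt_app_of_mem y hpos
  rw [Real.coe_toNNReal _ (sub_pos.2 hst).le] at h
  have hlin : HasDerivAt (fun s : ℝ => t - s) (-1 : ℝ) s₀ := by simpa using (hasDerivAt_id s₀).const_sub t
  have hc := h.scomp s₀ hlin
  simpa [Function.comp_def] using hc

/-- **Product rule** (Engel–Nagel B.16 / proof of III.1.7): if `v` has derivative `v′` at `s₀ < t` within
`U` and `v(s₀) ∈ D(A)`, then `s ↦ T(t − s)v(s)` has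
derivative `T(t − s₀)v′ − T(t − s₀)A v(s₀)` at `s₀` within `U`. [cite: EngelNagel2000, Ch. III Cor. 1.7 (proof)] -/
theorem hasDerivWithinAt_app_sub_apply (T : C0Semigroup 𝕜 E) {t s₀ : ℝ} (hst : s₀ < t) {U : Set ℝ}
    {v : ℝ → E} {v' : E} (hv : HasDerivWithinAt v v' U s₀) (hy : v s₀ ∈ T.generator.domain) :
    HasDerivWithinAt (fun s : ℝ => T.app (t - s).toNNReal (v s))
      (T.app (t - s₀).toNNReal v' - T.app (t - s₀).toNNReal (T.generator ⟨v s₀, hy⟩)) U s₀ := by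
  -- second term: the orbit of the fixed vector `v s₀ ∈ D(A)`
  have h2 : HasDerivWithinAt (fun s : ℝ => T.app (t - s).toNNReal (v s₀))
      (-(T.app (t - s₀).toNNReal (T.generator ⟨v s₀, hy⟩))) U s₀ :=
    (T.hasDerivAt_app_sub_const hst ⟨v s₀, hy⟩).hasDerivWithinAt
  -- first term: `T(t − s)` applied to the difference quotients of `v`
  have h1 : HasDerivWithinAt (fun s : ℝ => T.app (t - s).toNNReal (v s) - T.app (t - s).toNNReal (v s₀))
      (T.app (t - s₀).toNNReal v') U s₀ := by
    rw [hasDerivWithinAt_iff_tendsto_slope]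
    have hsl : Tendsto (slope v s₀) (𝓝[U \ {s₀}] s₀) (𝓝 v') := hasDerivWithinAt_iff_tendsto_slope.1 hv
    have hτ : Tendsto (fun s : ℝ => (t - s).toNNReal) (𝓝[U \ {s₀}] s₀) (𝓝 (t - s₀).toNNReal) :=
      ((continuous_real_toNNReal.comp (continuous_const.sub continuous_id)).tendsto s₀).mono_left nhdsWithin_le_nhds
    have hbd : ∀ᶠ s in 𝓝[U \ {s₀}] s₀, (t - s).toNNReal ≤ (t - s₀ + 1).toNNReal := by
      filter_upwards [mem_nhdsWithin_of_mem_nhds (Ioi_mem_nhds (show s₀ - 1 < s₀ by linarith))] with s hs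
      exact Real.toNNReal_le_toNNReal (by linarith [mem_Ioi.1 hs])
    refine (T.tendsto_app_apply hτ hbd hsl).congr' ?_
    filter_upwards [self_mem_nhdsWithin] with s _
    simp only [slope, vsub_eq_sub, sub_self, sub_zero, ContinuousLinearMap.map_smul_of_tower, map_sub]
  have hf : (fun s : ℝ => T.app (t - s).toNNReal (v s)) =
      (fun s : ℝ => T.app (t - s).toNNReal (v s) - T.app (t - s).toNNReal (v s₀)) +
        fun s : ℝ => T.app (t - s).toNNReal (v s₀) := by
    funext s; simp only [Pi.add_apply, sub_add_cancel]
  rw [hf]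
  exact (h1.add h2).congr_deriv (by abel)

/-! ### §3 The variation of parameters formula and uniqueness -/

omit [NormedSpace ℝ E] [IsScalarTower ℝ 𝕜 E] in
/-- The Duhamel integrand `s ↦ T(t − s) K S(s) x` is continuous. [cite: EngelNagel2000, Ch. III Cor. 1.7] -/
theorem continuous_duhamel_integrand (T S : C0Semigroup 𝕜 E) (K : E →L[𝕜] E) (t : ℝ) (x : E) :
    Continuous fun s : ℝ => T.app (t - s).toNNReal (K (S.app s.toNNReal x)) :=
  T.continuous_app_sub_apply t (K.continuous.comp (S.continuous_app_toNNReal x))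

/-- **Variation of parameters on the domain** (Engel–Nagel III Cor. 1.7): if the generators of `S`
and `T` have the same domain and `A_S u = A_T u + K u` there, then for `x ∈ D(A)` and `t ≥ 0`
`S(t)x = T(t)x + ∫₀ᵗ T(t − s) K S(s)x ds` (the function `s ↦ T(t − s)S(s)x` has derivative
`T(t − s) K S(s) x` on `(0, t)`; fundamental theorem of calculus). [cite: EngelNagel2000, Ch. III Cor. 1.7] -/
theorem app_eq_add_integral_of_generator_of_mem (S T : C0Semigroup 𝕜 E) (K : E →L[𝕜] E)
    (hdom : ∀ u : E, u ∈ S.generator.domain ↔ u ∈ T.generator.domain)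
    (hgen : ∀ (u : E) (hS : u ∈ S.generator.domain) (hT : u ∈ T.generator.domain),
      S.generator ⟨u, hS⟩ = T.generator ⟨u, hT⟩ + K u)
    {x : E} (hx : x ∈ S.generator.domain) {t : ℝ} (ht : 0 ≤ t) :
    S.app t.toNNReal x = T.app t.toNNReal x + ∫ s in (0 : ℝ)..t, T.app (t - s).toNNReal (K (S.app s.toNNReal x)) := by
  set ψ : ℝ → E := fun s => T.app (t - s).toNNReal (S.app s.toNNReal x) with hψ
  have hcont : Continuous ψ := T.continuous_app_sub_apply t (S.continuous_app_toNNReal x)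
  have hderiv : ∀ s ∈ Ioo 0 t, HasDerivAt ψ (T.app (t - s).toNNReal (K (S.app s.toNNReal x))) s := by
    intro s hs
    obtain ⟨hs0, hst⟩ := hs
    have hsp : 0 < s.toNNReal := Real.toNNReal_pos.2 hs0
    have hv : HasDerivAt (fun s' : ℝ => S.app s'.toNNReal x) (S.app s.toNNReal (S.generator ⟨x, hx⟩)) s := by
      have h := S.hasDerivAt_app_of_mem ⟨x, hx⟩ hsp
      rwa [Real.coe_toNNReal _ hs0.le] at h
    have hyS : S.app s.toNNReal x ∈ S.generator.domain := S.app_mem_generator_domain hx _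
    have hyT : S.app s.toNNReal x ∈ T.generator.domain := (hdom _).1 hyS
    have hprod := (T.hasDerivWithinAt_app_sub_apply hst (U := Set.univ) hv.hasDerivWithinAt hyT).hasDerivAt
      Filter.univ_mem
    refine hprod.congr_deriv ?_
    have hcomm : S.generator ⟨S.app s.toNNReal x, hyS⟩ = S.app s.toNNReal (S.generator ⟨x, hx⟩) :=
      S.generator_app_comm ⟨x, hx⟩ _
    have hT' : T.generator ⟨S.app s.toNNReal x, hyT⟩ =
        S.app s.toNNReal (S.generator ⟨x, hx⟩) - K (S.app s.toNNReal x) := by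
      rw [← hcomm]
      exact eq_sub_of_add_eq (hgen _ hyS hyT).symm
    rw [hT', map_sub]
    abel
  have hint : IntervalIntegrable (fun s => T.app (t - s).toNNReal (K (S.app s.toNNReal x))) volume 0 t :=
    (continuous_duhamel_integrand T S K t x).intervalIntegrable _ _
  have hftc := intervalIntegral.integral_eq_sub_of_hasDerivAt_of_le ht hcont.continuousOn hderiv hint
  have hψt : ψ t = S.app t.toNNReal x := by
    simp only [hψ, sub_self, Real.toNNReal_zero, app_zero, one_apply_eq_self]
  have hψ0 : ψ 0 = T.app t.toNNReal x := by
    simp only [hψ, sub_zero, Real.toNNReal_zero, app_zero, one_apply_eq_self]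
  rw [hftc, hψt, hψ0]
  abel

omit [IsScalarTower ℝ 𝕜 E] in
/-- The Duhamel term `x ↦ ∫₀ᵗ T(t − s) K S(s)x ds` is continuous (indeed Lipschitz, by the local
bounds on `‖T(·)‖`, `‖S(·)‖`). [cite: EngelNagel2000, Ch. III Cor. 1.7] -/
theorem continuous_duhamel (T S : C0Semigroup 𝕜 E) (K : E →L[𝕜] E) {t : ℝ} (ht : 0 ≤ t) :
    Continuous fun x : E => ∫ s in (0 : ℝ)..t, T.app (t - s).toNNReal (K (S.app s.toNNReal x)) := by
  obtain ⟨MT, hMT⟩ := T.exists_norm_app_le t.toNNReal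
  obtain ⟨MS, hMS⟩ := S.exists_norm_app_le t.toNNReal
  have hMT0 : 0 ≤ MT := (norm_nonneg _).trans (hMT 0 bot_le)
  have hMS0 : 0 ≤ MS := (norm_nonneg _).trans (hMS 0 bot_le)
  set C : ℝ := MT * ‖K‖ * MS with hC
  -- pointwise bound on the integrand applied to a difference
  have hbound : ∀ (y : E), ∀ s ∈ Set.uIoc (0 : ℝ) t, ‖T.app (t - s).toNNReal (K (S.app s.toNNReal y))‖ ≤ C * ‖y‖ := by
    intro y s hs
    rw [uIoc_of_le ht] at hs
    have hs1 : (t - s).toNNReal ≤ t.toNNReal := Real.toNNReal_le_toNNReal (by linarith [hs.1])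
    have hs2 : s.toNNReal ≤ t.toNNReal := Real.toNNReal_le_toNNReal hs.2
    calc ‖T.app (t - s).toNNReal (K (S.app s.toNNReal y))‖
        ≤ ‖T.app (t - s).toNNReal‖ * (‖K‖ * (‖S.app s.toNNReal‖ * ‖y‖)) :=
          (ContinuousLinearMap.le_opNorm _ _).trans (mul_le_mul_of_nonneg_left
            ((K.le_opNorm _).trans (mul_le_mul_of_nonneg_left (ContinuousLinearMap.le_opNorm _ _) (norm_nonneg _)))
            (norm_nonneg _))
      _ ≤ MT * (‖K‖ * (MS * ‖y‖)) := by gcongr; exacts [hMT _ hs1, hMS _ hs2]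
      _ = C * ‖y‖ := by rw [hC]; ring
  rw [continuous_iff_continuousAt]
  intro x₀
  rw [ContinuousAt, tendsto_iff_norm_sub_tendsto_zero]
  have hlim : Tendsto (fun x : E => C * |t - 0| * ‖x - x₀‖) (𝓝 x₀) (𝓝 0) := by
    have hc : Continuous fun x : E => C * |t - 0| * ‖x - x₀‖ := continuous_const.mul (continuous_id.sub continuous_const).norm
    have := hc.tendsto x₀
    rwa [sub_self, norm_zero, mul_zero] at this
  refine squeeze_zero' (Eventually.of_forall fun x => norm_nonneg _) (Eventually.of_forall fun x => ?_) hlim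
  have hi : ∀ y : E, IntervalIntegrable (fun s => T.app (t - s).toNNReal (K (S.app s.toNNReal y))) volume 0 t :=
    fun y => (continuous_duhamel_integrand T S K t y).intervalIntegrable _ _
  rw [← intervalIntegral.integral_sub (hi x) (hi x₀)]
  have hcongr : (fun s => T.app (t - s).toNNReal (K (S.app s.toNNReal x)) - T.app (t - s).toNNReal (K (S.app s.toNNReal x₀)))
      = fun s => T.app (t - s).toNNReal (K (S.app s.toNNReal (x - x₀))) := by
    funext s; simp only [map_sub]
  rw [hcongr]
  calc ‖∫ s in (0 : ℝ)..t, T.app (t - s).toNNReal (K (S.app s.toNNReal (x - x₀)))‖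
      ≤ C * ‖x - x₀‖ * |t - 0| := intervalIntegral.norm_integral_le_of_norm_le_const (hbound (x - x₀))
    _ = C * |t - 0| * ‖x - x₀‖ := by ring

/-- **VARIATION OF PARAMETERS FORMULA (Engel–Nagel III Cor. 1.7).**  Let `S`, `T` be C₀-semigroups on
a Banach space whose generators have the same domain and satisfy `A_S u = A_T u + K u` there, `K`
bounded.  Then for EVERY `x` and `t ≥ 0`:  `S(t)x = T(t)x + ∫₀ᵗ T(t − s) K S(s)x ds`.  (On `D(A)` by
`app_eq_add_integral_of_generator_of_mem`; both sides are continuous in `x` and `D(A)` is dense.)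
[cite: EngelNagel2000, Ch. III Cor. 1.7] -/
theorem app_eq_add_integral_of_generator (S T : C0Semigroup 𝕜 E) (K : E →L[𝕜] E)
    (hdom : ∀ u : E, u ∈ S.generator.domain ↔ u ∈ T.generator.domain)
    (hgen : ∀ (u : E) (hS : u ∈ S.generator.domain) (hT : u ∈ T.generator.domain),
      S.generator ⟨u, hS⟩ = T.generator ⟨u, hT⟩ + K u)
    (x : E) {t : ℝ} (ht : 0 ≤ t) :
    S.app t.toNNReal x = T.app t.toNNReal x + ∫ s in (0 : ℝ)..t, T.app (t - s).toNNReal (K (S.app s.toNNReal x)) := by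
  have hdense : Dense (S.generator.domain : Set E) := S.dense_generator_domain_of_normedSpace_real
  have hf : Continuous fun x : E => S.app t.toNNReal x := (S.app t.toNNReal).continuous
  have hg : Continuous fun x : E => T.app t.toNNReal x
      + ∫ s in (0 : ℝ)..t, T.app (t - s).toNNReal (K (S.app s.toNNReal x)) :=
    (T.app t.toNNReal).continuous.add (continuous_duhamel T S K ht)
  have hsub : (S.generator.domain : Set E) ⊆ {x | S.app t.toNNReal x
      = T.app t.toNNReal x + ∫ s in (0 : ℝ)..t, T.app (t - s).toNNReal (K (S.app s.toNNReal x))} :=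
    fun x hx => app_eq_add_integral_of_generator_of_mem S T K hdom hgen hx ht
  have hcl := (isClosed_eq hf hg).closure_subset_iff.2 hsub
  rw [hdense.closure_eq] at hcl
  exact hcl (Set.mem_univ x)

/-- **UNIQUENESS (Engel–Nagel II Thm. 1.4): a C₀-semigroup on a Banach space is determined by its
generator** — if `S.generator = T.generator` then `S(t) = T(t)` for all `t ≥ 0` (the case `K = 0` of the
variation of parameters formula). [cite: EngelNagel2000, Ch. II Thm. 1.4] -/
theorem app_eq_of_generator_eq (S T : C0Semigroup 𝕜 E) (h : S.generator = T.generator) (t : ℝ≥0) :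
    S.app t = T.app t := by
  have hdom : ∀ u : E, u ∈ S.generator.domain ↔ u ∈ T.generator.domain := fun u => by rw [h]
  have hgen : ∀ (u : E) (hS : u ∈ S.generator.domain) (hT : u ∈ T.generator.domain),
      S.generator ⟨u, hS⟩ = T.generator ⟨u, hT⟩ + (0 : E →L[𝕜] E) u := by
    intro u hS hT
    have hgr : ((u : E), S.generator ⟨u, hS⟩) ∈ T.generator.graph := by
      rw [← h]; exact S.generator.mem_graph ⟨u, hS⟩
    rw [zero_apply, add_zero]
    exact (T.generator.mem_graph_snd_inj (T.generator.mem_graph ⟨u, hT⟩) hgr rfl).symm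
  ext x
  have key := app_eq_add_integral_of_generator S T 0 hdom hgen x t.coe_nonneg
  simpa using key

/-- Uniqueness as an equality of C₀-semigroups. [cite: EngelNagel2000, Ch. II Thm. 1.4] -/
theorem eq_of_generator_eq (S T : C0Semigroup 𝕜 E) (h : S.generator = T.generator) : S = T :=
  StrongContRepresentation.ext fun g => app_eq_of_generator_eq S T h (Multiplicative.toAdd g)

end C0Semigroup

end Literature.Analysis.UnboundedOperators
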